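import Summits.HubbardSuperconductivity.HubbardSuperconductivity.Theses.ColourTheSpin
import Literature.MathematicalPhysics.QuantumLattice.SpinGaugedHubbardTorus

/-!
# Route `ColourTheSpin`, support item `SgHoppingDictionary` (stmt-HubbardSuperconductivity-16276)

DICTIONARY II: for `L ≥ 3` the diagonal link block of the route's `H_g(L,U)` (the inlined `let H`,
definitionally `spinGaugedHubbardTorus L U g`, `spinGaugedHubbardTorus_eq_inline`) at the trivial
configuration is the summit's `hubbardTorus 2 L 1 U` plus the constant electric energy
`(7/8) g² |Bond L|` — literally the landed Literature theorem `spinGaugedHubbardTorus_apply_one_one`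
(Kogut–Susskind (1975); the trivial configuration is the constant `(0, 0)`, `one_eq_const_zero`).
[folklore]
-/

namespace Summit.HubbardSuperconductivity.ColourTheSpin

open Literature.MathematicalPhysics.QuantumLattice

/-- **Route item `SgHoppingDictionary`**: for `L ≥ 3`,
`H_g (s,1) (s',1) = hubbardTorus 2 L 1 U s s' + δ_{s,s'} · (7/8) g² |Bond L|` (the landed
`spinGaugedHubbardTorus_apply_one_one`, transported along the definitional identities
`spinGaugedHubbardTorus_eq_inline` and `one_eq_const_zero`). Kogut–Susskind, PRD 11 (1975) 395.
[folklore] -/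
theorem sgHoppingDictionary_proof :
    Summit.HubbardSuperconductivity.HubbardSuperconductivity.Theses.ColourTheSpin.SgHoppingDictionary := by
  intro L _ hL U g s s'
  have h := spinGaugedHubbardTorus_apply_one_one L hL U g s s'
  rw [one_eq_const_zero, spinGaugedHubbardTorus_eq_inline] at h
  exact h

end Summit.HubbardSuperconductivity.ColourTheSpin
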